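import Mathlib.NumberTheory.Chebyshev
import Literature.NumberTheory.Irrationality.Zudilin2002.Recursion
import HarnessLib

/-!
# Zudilin's third-order recursion for `ζ(5)` — complements to `Recursion.lean`

Topic `Literature/NumberTheory/Irrationality/Zudilin2002`. W. Zudilin, *A third-order Apéry-like
recursion for `ζ(5)`*, Mat. Zametki **72** (2002) 796–800 = Math. Notes **72** (2002) 733–737,
arXiv:math/0206178 [Zudilin2002ZetaFive] (= bib key `Zudilin2002Zeta5` of the sibling file).
HONEST FRAMING (cell pub-zeta5): systematic search; no irrationality claim unless certified — nothing in
this file asserts anything about the arithmetic nature of `ζ(5)`.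

The recursion (1), its coefficients `a₀, a₁, a₂`, the printed solutions `q, p, ptilde`, the forms
`ell, ellTilde` and Theorem 1 (named facts `theorem1_signs`, `theorem1_rates`) live in the sibling file
`Recursion.lean` (seat pub-zeta5-p1, p194535). This file adds only what that file does not contain:

* `p_three_div_q_three` — the third row of the printed table, `p₃/q₃ = 7682021239/7408444032`, PROVED by
  kernel evaluation of the recursion from the printed initial data (a check of the transcription of the
  degree-9 coefficients; the cell's calibration script `code/calibration/zudilin2002_recursion_check.py`
  re-derives rows `n = 1..5` in exact arithmetic independently) [Zudilin2002ZetaFive, §1, table];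
* `integrality` — the NAMED FACT (statement only) of the inclusions the source derives from (14)–(15):
  "Further construction of the above solutions of the difference equation (1) leads to the inclusions
  `4Dₙ²qₙ ∈ ℤ, 4Dₙ⁷pₙ ∈ ℤ, 4Dₙ⁵p̃ₙ ∈ ℤ, n = 1,2,…` (see relations (14) and (15)), where `Dₙ` denotes
  the least common multiple of the numbers `1,2,…,n`" [Zudilin2002ZetaFive, §1 (display before (6)) and
  §2 (14)–(15)], with `Dₙ = Nat.lcmUpto n`. (These follow in print from the Vasilyev/Zudilin integral =
  very-well-poised-series identities behind (14); a discharge formalises §2.)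

Deliberately NOT here (as in `Recursion.lean`): the sharper display (6) `qₙ ∈ ℤ, 2Dₙ⁵pₙ ∈ ℤ, 2Dₙ³p̃ₙ ∈ ℤ`,
stated in the source from "straightforward calculations on the basis of the recursion (1)" and, for the
equivalent cellular normalisation, PROVED only for `qₙ` and OBSERVED for `pₙ, p̃ₙ` by Brown–Zudilin
(arXiv:2210.03391, §2 (6)–(7)); the cell tests it by computation, it is not vendored as a fact.

History: version 1 of this file (p194528) was written in parallel with `Recursion.lean` and declared the
same names (`a₀, a₁, a₂, sol, q, p, …`) in the same namespace; this version removes every duplicate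
(its `theorem1` is `theorem1_signs ∧ theorem1_rates` of `Recursion.lean`) so that both modules import
together.
-/

noncomputable section

namespace Literature.NumberTheory.Irrationality.Zudilin2002

/-- Third row of the printed table: `p₃/q₃ = 7682021239/7408444032` (kernel evaluation of the recursion
(1) from the printed initial data). [cite: Zudilin2002Zeta5, Sect. 1 (table, row n = 3)] -/
theorem p_three_div_q_three : p 3 / q 3 = 7682021239 / 7408444032 := by
  norm_num [p, q, sol, rec3, rec3Aux, step, a₀, a₁, a₂]

/-- The integrality derived in the source from (14)–(15): for `n ≥ 1`,
`4Dₙ²qₙ ∈ ℤ`, `4Dₙ⁷pₙ ∈ ℤ`, `4Dₙ⁵p̃ₙ ∈ ℤ`, `Dₙ = lcm(1,…,n) = Nat.lcmUpto n`. Named fact (statement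
only). [cite: Zudilin2002Zeta5, Sect. 1 (display before (6)) and Sect. 2 (14)–(15)] -/
def integrality : Prop :=
  ∀ n : ℕ, 1 ≤ n →
    (∃ z : ℤ, 4 * (Nat.lcmUpto n : ℚ) ^ 2 * q n = z) ∧
    (∃ z : ℤ, 4 * (Nat.lcmUpto n : ℚ) ^ 7 * p n = z) ∧
    (∃ z : ℤ, 4 * (Nat.lcmUpto n : ℚ) ^ 5 * ptilde n = z)

end Literature.NumberTheory.Irrationality.Zudilin2002
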